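import Summits.BirchSwinnertonDyer.BirchSwinnertonDyer.Theorems.PrintCf2DisegniPairTwoTameTransport
import Summits.BirchSwinnertonDyer.BirchSwinnertonDyer.Theorems.PrintCf2DisegniPairTwoTwistScaling
import HarnessLib

/-!
# Road (C) `disegni-pair-two` on crux stmt-BirchSwinnertonDyer-20368 — BIRCH TRANSPORT on the period side and
# the `χ₈`-class defect key in BASE currency: the period-ratio "class constant" `v₂(ϖ(V))` CANCELS

Cell `bsd-print-cf2`, width seat `bsd-line-cf2-p1-w8` g24; sequel of `PrintCf2DisegniPairTwoTameTransport.lean` (the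
`2`-adic side) and `PrintCf2DisegniPairTwoTwistScaling.lean` (`defectKey_chi8_modulo_descent_min`).
`--supports stmt-BirchSwinnertonDyer-20368` (helper). THEOREMS ONLY (no `def`, no named fact, no `sorry`); conditional on
every displayed hypothesis. BSD is not proved by any of this; no summit statement is claimed; 20368 is not closed here.

## What is proved (`E` a globally minimal base good ordinary at `2`; `d > 0`, `d ≡ 1 (4)`, squarefree, `(d, N_E) = 1`;
`V = C₀ • E^{(d)}` globally minimal; `f_E`, `f_V` the newforms; `χ_d = (·/d)`)

* §1 `plusPeriodRatio_twist_of_birch` (real algebra): from Birch's `c²·d·(Ω⁺_{f_V})² = (Ω⁺_{f_E})²`, Pal's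
  `Ω(V)·√d = |u₀|·Ω(E)` and a plus period ratio `ϖ_E·Ω(E) = Ω⁺_{f_E}` of the BASE, the twist has the EXPLICIT plus
  period ratio `ϖ_V := ϖ_E/|c·u₀|`: `ϖ_V·Ω(V) = Ω⁺_{f_V}` — no parametrisation datum of `V`, no optimality input;
  `padicValRat_div_abs_mul` (`v₂(ϖ_E/|c u₀|) = v₂(ϖ_E) − v₂(c) − v₂(u₀)`).
* §2 ★★ `exists_plusPeriodRatio_twist` — the same packaged over the tree objects (`u₀ = u(C₀)`), and
  ★★★ `valuation_deriv_add_plusPeriodRatio_twist`: with `D_V`, `D_G` the derivative functionals at `T = −2` of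
  `L₂(f_V, α_V, ·)` and of the TAME function `G = L₂(f_E, d, α_E, χ_d, ·)`,
  **`v₂(D_V) + v₂(ϖ_V) + v₂(u₀) = v₂(D_G) + v₂(ϖ_E)`** — Birch's constant `c` has CANCELLED.
* §3 ★★★ `defectKey_chi8_base_currency` — `defectKey_chi8_modulo_descent_min` for a member `W` over `V = C₀ • E^{(d)}`
  with its `2`-adic object and its period constant moved to the base:
  `v₂(q) + v₂(Tam W) + v₂(h₂) + v₂(u₀) = v₂(D_G) + 2 + 2v₂(#W(ℚ)_tors) + v₂(ϖ_E)` (`D_G ≠ 0`), where `ϖ_E` is ONE number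
  for the whole class and `u₀ = ±1` as soon as `E` is semistable at the primes of `d` (Pal Prop. 2.5; `cm7`: every
  `d` prime to `7`). The cm7 specialisation (`ϖ_E = 1` from `OptimalCurveManinCertificate cm7`, `u₀ = ±1`) is the sequel
  `…TamePeriodTransportCm7.lean`.

References: B. Mazur, J. Tate, J. Teitelbaum, Invent. Math. 84 (1986) §I.8 [MazurTateTeitelbaum1986Invent]; V. Pal,
Proc. AMS 140 (2012) Prop. 2.5, Thm. 3.2 [Pal2012]; K. Matsuno, J. Number Theory 84 (2000) §2 [Matsuno2000];
D. Disegni, Compos. Math. 153 (2017) Thm. B [Disegni2017].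
-/

set_option autoImplicit false
set_option linter.dupNamespace false

noncomputable section

open scoped Classical MatrixGroups ModularForm NumberField NumberTheorySymbols

open CongruenceSubgroup NumberField IsDedekindDomain WeierstrassCurve WeierstrassCurve.Affine.Point PowerSeries
  Literature.NumberTheory.EllipticCurves Literature.NumberTheory.EllipticCurves.ModularForms
  Literature.NumberTheory.EllipticCurves.Disegni2017 Literature.NumberTheory.GaloisRepresentations
  Literature.NumberTheory.EllipticCurves.GreenbergVatsal2000 Summit.BirchSwinnertonDyer.Rank1Residual.AdditivePotMult

namespace Summit.BirchSwinnertonDyer.BirchSwinnertonDyer.Theorems.PrintCf2.DisegniPairTwo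

/-! ### §1 Real and valuation algebra of the period transport -/

section Algebra

/-- **The plus period ratio of the twist, explicitly**: from `c²·d·P_V² = P_E²` (Birch), `Ω_V·√d = |u₀|·Ω_E` (Pal) and
`ϖ_E·Ω_E = P_E` with `P_V, P_E > 0`, `c, u₀ ≠ 0`: `(ϖ_E/|c u₀|)·Ω_V = P_V`. [cite: MazurTateTeitelbaum1986Invent, §I.8]
[cite: Pal2012, Thm. 3.2 (case d > 0)] -/
theorem plusPeriodRatio_twist_of_birch {c ϖE u₀ : ℚ} {d : ℤ} {ΩV ΩE PV PE : ℝ} (hd : 0 < d) (hc : c ≠ 0)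
    (hu : u₀ ≠ 0) (hPV : 0 < PV) (hPE : 0 < PE) (hper : (c : ℝ) ^ 2 * (d : ℝ) * PV ^ 2 = PE ^ 2)
    (hϖE : (ϖE : ℝ) * ΩE = PE) (hPal : ΩV * Real.sqrt (d : ℝ) = |(u₀ : ℝ)| * ΩE) :
    ((ϖE / |c * u₀| : ℚ) : ℝ) * ΩV = PV := by
  have hdR : (0 : ℝ) < d := by exact_mod_cast hd
  have hsd : 0 < Real.sqrt (d : ℝ) := Real.sqrt_pos.mpr hdR
  have hsq : Real.sqrt (d : ℝ) ^ 2 = d := Real.sq_sqrt hdR.le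
  have hcR : (0 : ℝ) < |(c : ℝ)| := abs_pos.mpr (by exact_mod_cast hc)
  have huR : (0 : ℝ) < |(u₀ : ℝ)| := abs_pos.mpr (by exact_mod_cast hu)
  -- `X := (ϖE/|c u₀|)·Ω_V = P_E/(|c|√d)`
  have h1 : ((ϖE / |c * u₀| : ℚ) : ℝ) * ΩV = PE / (|(c : ℝ)| * Real.sqrt d) := by
    rw [eq_div_iff (mul_pos hcR hsd).ne']
    push_cast
    rw [abs_mul]
    have : (ϖE : ℝ) / (|(c : ℝ)| * |(u₀ : ℝ)|) * ΩV * (|(c : ℝ)| * Real.sqrt d) =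
        (ϖE : ℝ) * (ΩV * Real.sqrt d) / |(u₀ : ℝ)| := by
      field_simp
    rw [this, hPal, ← hϖE]
    field_simp
  have h2 : (PE / (|(c : ℝ)| * Real.sqrt d)) ^ 2 = PV ^ 2 := by
    rw [div_pow, mul_pow, sq_abs, hsq, ← hper]
    field_simp
  have h3 : 0 ≤ PE / (|(c : ℝ)| * Real.sqrt d) := (div_pos hPE (mul_pos hcR hsd)).le
  rw [h1]
  exact (pow_left_inj₀ h3 hPV.le two_ne_zero).mp h2

/-- `v_p(|q|) = v_p(q)`. [folklore] -/
theorem padicValRat_abs_eq {p : ℕ} (q : ℚ) : padicValRat p |q| = padicValRat p q := by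
  rcases abs_choice q with h | h
  · rw [h]
  · rw [h, padicValRat.neg]

/-- `v_p(ϖ/|c·u|) = v_p(ϖ) − v_p(c) − v_p(u)` for `ϖ, c, u ≠ 0`. [folklore] -/
theorem padicValRat_div_abs_mul {p : ℕ} [Fact p.Prime] {ϖ c u : ℚ} (hϖ : ϖ ≠ 0) (hc : c ≠ 0) (hu : u ≠ 0) :
    padicValRat p (ϖ / |c * u|) = padicValRat p ϖ - padicValRat p c - padicValRat p u := by
  have hcu : |c * u| ≠ 0 := abs_ne_zero.mpr (mul_ne_zero hc hu)
  rw [padicValRat.div hϖ hcu, padicValRat_abs_eq, padicValRat.mul hc hu]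
  ring

end Algebra

/-! ### §2 The plus period ratio of the twist and the cancellation of Birch's constant -/

section Transport

variable (E : WeierstrassCurve ℚ) [E.IsElliptic] [E.IsGloballyMinimal] {d : ℤ} {V : WeierstrassCurve ℚ}
  [V.IsElliptic] [V.IsGloballyMinimal] [NeZero (E.conductorNorm ℤ)] [NeZero (V.conductorNorm ℤ)] [NeZero d.natAbs]
  {fE : CuspForm (Gamma0 (E.conductorNorm ℤ)) 2} {fV : CuspForm (Gamma0 (V.conductorNorm ℤ)) 2}

omit [E.IsGloballyMinimal] [V.IsElliptic] [V.IsGloballyMinimal] [NeZero d.natAbs] in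
/-- ★★ **The plus period ratio of the twist from that of the base.** For `ϖ_E ∈ ℚˣ` with `ϖ_E·Ω(E) = Ω⁺_{f_E}` and
Birch's constant `c` (`c²·d·(Ω⁺_{f_V})² = (Ω⁺_{f_E})²`): `ϖ_V := ϖ_E/|c·u(C₀)| ∈ ℚˣ` satisfies `ϖ_V·Ω(V) = Ω⁺_{f_V}`
(Pal: `Ω(V)·√d = |u(C₀)|·Ω(E)`) and `v₂(ϖ_V) = v₂(ϖ_E) − v₂(c) − v₂(u(C₀))`. No parametrisation datum of `V` is used.
[cite: MazurTateTeitelbaum1986Invent, §I.8] [cite: Pal2012, Thm. 3.2 (case d > 0)] -/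
theorem exists_plusPeriodRatio_twist (hd : 0 < d) {C₀ : VariableChange ℚ} (hV : C₀ • E.quadraticTwist (d : ℚ) = V)
    (hfE : IsNewformOf E fE) (hfV : IsNewformOf V fV) {c : ℚ} (hc : c ≠ 0)
    (hper : (c : ℝ) ^ 2 * (d : ℝ) * plusPeriod fV ^ 2 = plusPeriod fE ^ 2)
    {ϖE : ℚ} (hϖE0 : ϖE ≠ 0) (hϖE : (ϖE : ℝ) * E.realPeriodRat = plusPeriod fE) :
    (ϖE / |c * (C₀.u : ℚ)|) ≠ 0 ∧ (((ϖE / |c * (C₀.u : ℚ)|) : ℚ) : ℝ) * V.realPeriodRat = plusPeriod fV ∧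
      padicValRat 2 (ϖE / |c * (C₀.u : ℚ)|) = padicValRat 2 ϖE - padicValRat 2 c - padicValRat 2 (C₀.u : ℚ) := by
  have hu : (C₀.u : ℚ) ≠ 0 := Units.ne_zero _
  have hPV : 0 < plusPeriod fV := IsNewform0.plusPeriod_pos_holds hfV.1 hfV.coeffField_eq_bot
  have hPE : 0 < plusPeriod fE := IsNewform0.plusPeriod_pos_holds hfE.1 hfE.coeffField_eq_bot
  have hdq : (0 : ℚ) < d := by exact_mod_cast hd
  have hPal := E.realPeriodRat_mul_sqrt_of_twist_of_pos hdq V C₀ hV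
  have hPal' : V.realPeriodRat * Real.sqrt (d : ℝ) = |((C₀.u : ℚ) : ℝ)| * E.realPeriodRat := by
    have e : (((d : ℚ)) : ℝ) = (d : ℝ) := Rat.cast_intCast d
    rw [← e]; exact hPal
  refine ⟨div_ne_zero hϖE0 (abs_ne_zero.mpr (mul_ne_zero hc hu)),
    plusPeriodRatio_twist_of_birch hd hc hu hPV hPE hper hϖE hPal', padicValRat_div_abs_mul hϖE0 hc hu⟩

/-- ★★★ **Cancellation of Birch's constant.** In the setting of `deriv_padicLFunction_twist_eq` (branch-point
vanishing of `L₂(f_V, α_V, ·)` at `T = −2`) with a plus period ratio `ϖ_E·Ω(E) = Ω⁺_{f_E}` of the base: there is a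
plus period ratio `ϖ_V` of the twist (`ϖ_V·Ω(V) = Ω⁺_{f_V}`) such that the tame function vanishes at `−2`,
`D_V ≠ 0 ↔ D_G ≠ 0`, and, when `D_G ≠ 0`,
**`v₂(D_V) + v₂(ϖ_V) + v₂(u(C₀)) = v₂(D_G) + v₂(ϖ_E)`**. [cite: MazurTateTeitelbaum1986Invent, §I.8 and §I.13]
[cite: Pal2012, Thm. 3.2 (case d > 0)] [cite: Matsuno2000, §2 (p. 84)] -/
theorem valuation_deriv_add_plusPeriodRatio_twist (hmod : exists_isNewformOf) (hd : 0 < d) (hd4 : d % 4 = 1)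
    (hsq : Squarefree d) (hcop : IsCoprime d (E.conductorNorm ℤ : ℤ)) {C₀ : VariableChange ℚ}
    (hV : C₀ • E.quadraticTwist (d : ℚ) = V) (hfE : IsNewformOf E fE) (hfV : IsNewformOf V fV)
    (hord : IsOrdinaryAt E 2) {χ : MulChar (ZMod d.natAbs) ℤ}
    (hχ : ∀ a : ZMod d.natAbs, χ a = J((a.val : ℤ) | d.natAbs))
    (h0 : HasSum (fun k : ℕ ↦ PowerSeries.coeff k (padicLFunction fV (unitRoot V 2 : ℚ_[2])) *
      (-2 : ℚ_[2]) ^ k) 0)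
    {ϖE : ℚ} (hϖE0 : ϖE ≠ 0) (hϖE : (ϖE : ℝ) * E.realPeriodRat = plusPeriod fE) :
    ∃ ϖV : ℚ, ϖV ≠ 0 ∧ (ϖV : ℝ) * V.realPeriodRat = plusPeriod fV ∧
      HasSum (fun k : ℕ ↦ PowerSeries.coeff k (padicLFunctionTame fE d.natAbs (unitRoot E 2 : ℚ_[2])
        ((χ.ringHomComp (Int.castRingHom ℚ)).ringHomComp (Rat.castHom ℚ_[2]))) * (-2 : ℚ_[2]) ^ k) 0 ∧
      ((∑' k : ℕ, PowerSeries.coeff k (padicLFunction fV (unitRoot V 2 : ℚ_[2])) * (k : ℚ_[2]) *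
            (-2) ^ (k - 1)) ≠ 0 ↔
        (∑' k : ℕ, PowerSeries.coeff k (padicLFunctionTame fE d.natAbs (unitRoot E 2 : ℚ_[2])
            ((χ.ringHomComp (Int.castRingHom ℚ)).ringHomComp (Rat.castHom ℚ_[2]))) * (k : ℚ_[2]) *
              (-2) ^ (k - 1)) ≠ 0) ∧
      ((∑' k : ℕ, PowerSeries.coeff k (padicLFunctionTame fE d.natAbs (unitRoot E 2 : ℚ_[2])
            ((χ.ringHomComp (Int.castRingHom ℚ)).ringHomComp (Rat.castHom ℚ_[2]))) * (k : ℚ_[2]) *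
              (-2) ^ (k - 1)) ≠ 0 →
        (∑' k : ℕ, PowerSeries.coeff k (padicLFunction fV (unitRoot V 2 : ℚ_[2])) * (k : ℚ_[2]) *
            (-2) ^ (k - 1)).valuation + padicValRat 2 ϖV + padicValRat 2 (C₀.u : ℚ) =
          (∑' k : ℕ, PowerSeries.coeff k (padicLFunctionTame fE d.natAbs (unitRoot E 2 : ℚ_[2])
            ((χ.ringHomComp (Int.castRingHom ℚ)).ringHomComp (Rat.castHom ℚ_[2]))) * (k : ℚ_[2]) *
              (-2) ^ (k - 1)).valuation + padicValRat 2 ϖE) := by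
  obtain ⟨c, hc0, hper, hGsum, hiff, hval⟩ :=
    valuation_deriv_padicLFunction_twist_eq E hmod hd hd4 hsq hcop hV hfE hfV hord hχ h0
  obtain ⟨hϖV0, hϖV, hvϖV⟩ := exists_plusPeriodRatio_twist E hd hV hfE hfV hc0 hper hϖE0 hϖE
  refine ⟨_, hϖV0, hϖV, hGsum, hiff, fun hG ↦ ?_⟩
  rw [hval hG, hvϖV]
  ring

end Transport

variable (ι : PadicAlgCl 2 ≃+* ℂ) (K : Type) [Field K] [NumberField K] [IsGalois ℚ K]

/-! ### §3 The `χ₈`-class defect key in BASE currency -/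

/-- ★★★ **The defect key of the `χ₈∘N`-class MODULO (Δ1), in BASE currency.** Setting of
`defectKey_chi8_modulo_descent_min` for a globally minimal member `W` over the good curve `V`, where now
`V = C₀ • E^{(d)}` is a twist of a BASE curve `E` (globally minimal, good ordinary at `2`; `d > 0`, `d ≡ 1 (4)`,
squarefree, `(d, N_E) = 1`) carrying a plus period ratio `ϖ_E·Ω(E) = Ω⁺_{f_E}`. Then the tame `χ_d`-twisted `2`-adic
`L`-function `G = L₂(f_E, d, α_E, χ_d, ·)` of the FIXED form `f_E` has `D_G = Σ_k k[T^k]G(−2)^{k−1} ≠ 0`, and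
`shaAn W = q ∈ ℚˣ` with
`v₂(q) + v₂(Tam W) + v₂(h₂) + v₂(u(C₀)) = v₂(D_G) + 2 + 2v₂(#W(ℚ)_tors) + v₂(ϖ_E)`:
the period ratio of `V` is GONE (Birch's constant cancels between `D_V = c·u·D_G` and `ϖ_V = ϖ_E/|c u(C₀)|`).
[cite: Disegni2017, Theorem B] [cite: MazurTateTeitelbaum1986Invent, §I.8 and §I.13] [cite: Pal2012, Thm. 3.2] -/
theorem defectKey_chi8_base_currency (hGZ73 : GrossZagier1986_thm_I_7_3) (h2 : Module.finrank ℚ K = 2)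
    (hsplit : ((Ideal.span {(2 : ℤ)}).primesOver (𝓞 K)).ncard = 2)
    (𝔭 𝔭' : HeightOneSpectrum (𝓞 K)) (h𝔭 : ((2 : ℕ) : 𝓞 K) ∈ 𝔭.asIdeal)
    (h𝔭' : ((2 : ℕ) : 𝓞 K) ∈ 𝔭'.asIdeal)
    (κ : DirichletCharacter ℂ (NumberField.discr K).natAbs)
    (hκ : ∀ ℓ : ℕ, ℓ.Prime → ℓ ≠ 2 → κ ℓ = (jacobiSym (NumberField.discr K) ℓ : ℂ))
    (hκ2 : κ 2 = if NumberField.discr K % 8 = 1 then 1 else if NumberField.discr K % 8 = 5 then -1 else 0)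
    (hd : Nat.Coprime 2 (NumberField.discr K).natAbs)
    -- the base curve, the twist parameter and the good pair
    (E : WeierstrassCurve ℚ) [E.IsElliptic] [E.IsGloballyMinimal] [NeZero (E.conductorNorm ℤ)]
    {fE : CuspForm (Gamma0 (E.conductorNorm ℤ)) 2} (hfE : IsNewformOf E fE) (hordE : IsOrdinaryAt E 2)
    (hmodf : exists_isNewformOf) {d : ℤ} [NeZero d.natAbs] (hd0 : 0 < d) (hd4 : d % 4 = 1) (hsq : Squarefree d)
    (hcop : IsCoprime d (E.conductorNorm ℤ : ℤ)) {χJ : MulChar (ZMod d.natAbs) ℤ}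
    (hχJ : ∀ a : ZMod d.natAbs, χJ a = J((a.val : ℤ) | d.natAbs))
    {ϖE : ℚ} (hϖE0 : ϖE ≠ 0) (hϖE : (ϖE : ℝ) * E.realPeriodRat = plusPeriod fE)
    (V V' : WeierstrassCurve ℚ) [V.IsElliptic] [V.IsGloballyMinimal] [V'.IsElliptic] [V'.IsGloballyMinimal]
    [NeZero (V.conductorNorm ℤ)] {C₀ : VariableChange ℚ} (hV : C₀ • E.quadraticTwist (d : ℚ) = V)
    (hordV' : IsOrdinaryAt V' 2) (hap : V'.frobeniusTrace 2 = V.frobeniusTrace 2)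
    {N' : ℕ} [NeZero N'] {f : CuspForm (Gamma0 (V.conductorNorm ℤ)) 2}
    {f' : CuspForm (Gamma0 N') 2} (hfV : IsNewformOf V f) (hfV' : IsNewformOf V' f')
    (hV' : ∀ n : ℕ, cuspCoeff f' n = κ (n : ZMod _) * cuspCoeff f n)
    (h0 : HasSum (fun k : ℕ ↦ PowerSeries.coeff k (padicLFunction f (unitRoot V 2 : ℚ_[2])) *
      (-2 : ℚ_[2]) ^ k) 0)
    -- the member (analytic rank one, rank one) and its companion
    (hmod : hasEntireLFunction_rat) {M M' : ℕ} [NeZero M] [NeZero M']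
    {g : CuspForm (Gamma0 M) 2} {g' : CuspForm (Gamma0 M') 2}
    (W W' : WeierstrassCurve ℚ) [W.IsElliptic] [W.IsGloballyMinimal] [W'.IsElliptic]
    (hg : IsNewformOf W g) (hg' : IsNewformOf W' g')
    (hgε : ∀ m : ℕ, cuspCoeff g m = (ZMod.χ₈.ringHomComp (Int.castRingHom ℂ)) m * cuspCoeff f m)
    (hg'ε : ∀ m : ℕ, cuspCoeff g' m = (ZMod.χ₈.ringHomComp (Int.castRingHom ℂ)) m * cuspCoeff f' m)
    (hr : W.analyticRank = 1) (hrk : W.mordellWeilRank = 1) (hL' : W'.entireLFunction 1 ≠ 0)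
    -- the tower frame and the sign character
    {H : Type} [Field H] [NumberField H] [Algebra K H] (hKH : Module.finrank K H = 2) {t : H}
    (htK : t ∉ Set.range (algebraMap K H)) (ht2 : t ^ 2 = algebraMap ℚ H 2)
    (G : Subgroup (H ≃ₐ[ℚ] H)) (χ : G →* ℂˣ) (s : G → ℤ) (hs : ∀ σ, ((χ σ : ℂˣ) : ℂ) = (s σ : ℂ))
    (τ : H ≃ₐ[ℚ] H) (hτG : τ ∈ G) (hsτ : s ⟨τ, hτG⟩ = -1)
    (hτK : ∀ a : K, τ (algebraMap K H a) = algebraMap K H a) (hτt : τ t = -t)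
    {u : K} {e : ℚ} (hu : u ∉ Set.range (algebraMap ℚ K)) (hue : u ^ 2 = algebraMap ℚ K e)
    (c : K ≃ₐ[ℚ] K) (hcu : c u = -u)
    -- the member's explicit model `V^{(2)} = C • W` and its Mordell–Weil generator
    [(V.quadraticTwist 2).IsElliptic] {C : VariableChange ℚ} (hC : C • W = V.quadraticTwist 2)
    {P : (V.quadraticTwist 2).toAffine.Point}
    (hgen : ∀ R : (V.quadraticTwist 2).toAffine.Point,
      ∃ (k : ℤ) (T : (V.quadraticTwist 2).toAffine.Point), IsOfFinAddOrder T ∧ R = k • P + T)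
    (htors : ∀ Q : ((V.quadraticTwist 2).quadraticTwist e).toAffine.Point, IsOfFinAddOrder Q)
    -- Disegni's datum: invariance, PIN, and the conjoined clauses (PRINT stub of the road)
    (DH : PAdicHeightDataK V 2 H)
    (hDH : ∀ (σ : G) (a b : (V.baseChange H).toAffine.Point),
      DH.pairing (pointGalHom V H σ.1 a) (pointGalHom V H σ.1 b) = DH.pairing a b)
    {h₂ : ℚ_[2]}
    (hpin : DH.pairing
      (twistPointEquivOver V (not_mem_range_rat_of_not_mem_range htK) ht2
        (QuadraticDescent.incl H (V.quadraticTwist 2) P))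
      (twistPointEquivOver V (not_mem_range_rat_of_not_mem_range htK) ht2
        (QuadraticDescent.incl H (V.quadraticTwist 2) P)) = h₂)
    (hGZ : ChiLineGrossZagierClauses ι K V H f (ι (((unitRoot V 2 : ℚ_[2]) : PadicAlgCl 2)))
      (baseChangeDirichlet K (ZMod.χ₈.ringHomComp (Int.castRingHom ℂ))) 𝔭 𝔭' G χ DH)
    -- Bertrand: the 2-adic height of the member's generator is non-zero
    (hh₂ : h₂ ≠ 0) :
    (∑' k : ℕ, PowerSeries.coeff k (padicLFunctionTame fE d.natAbs (unitRoot E 2 : ℚ_[2])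
        ((χJ.ringHomComp (Int.castRingHom ℚ)).ringHomComp (Rat.castHom ℚ_[2]))) * (k : ℚ_[2]) *
          (-2) ^ (k - 1)) ≠ 0 ∧
    ∃ q : ℚ, shaAn W = (q : ℂ) ∧ q ≠ 0 ∧
      padicValRat 2 q + (padicValNat 2 W.tamagawaProduct : ℤ) + h₂.valuation + padicValRat 2 (C₀.u : ℚ) =
        (∑' k : ℕ, PowerSeries.coeff k (padicLFunctionTame fE d.natAbs (unitRoot E 2 : ℚ_[2])
            ((χJ.ringHomComp (Int.castRingHom ℚ)).ringHomComp (Rat.castHom ℚ_[2]))) * (k : ℚ_[2]) *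
              (-2) ^ (k - 1)).valuation + 2 +
          2 * (padicValNat 2 W.torsionOrder : ℤ) + padicValRat 2 ϖE := by
  -- `V` is ordinary at `2` and its level is odd
  obtain ⟨hordV, -⟩ := exists_birchConstant_two E hmodf hd0 hd4 hsq hcop hV hfE hfV hordE hχJ
  have hN : ¬ 2 ∣ V.conductorNorm ℤ := not_two_dvd_level_of_isOrdinaryAt hfV hordV
  -- the period ratio of `V` from the base and the cancellation of Birch's constant
  obtain ⟨ϖV, hϖV0, hϖV, -, hiff, hval⟩ := valuation_deriv_add_plusPeriodRatio_twist E hmodf hd0 hd4 hsq hcop hV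
    hfE hfV hordE hχJ h0 hϖE0 hϖE
  -- the defect key in `f_V`-currency with this `ϖ_V`
  obtain ⟨hD, q, hq, hq0, hv⟩ := defectKey_chi8_modulo_descent_min ι K hGZ73 h2 hsplit 𝔭 𝔭' h𝔭 h𝔭' κ hκ hκ2 hd V V'
    hordV hordV' hap hN hfV hfV' hV' h0 hmod W W' hg hg' hgε hg'ε hr hrk hL' hKH htK ht2 G χ s hs τ hτG hsτ hτK hτt hu
    hue c hcu hC hgen htors DH hDH hpin hGZ hϖV0 hϖV hh₂
  have hDG := hiff.mp hD
  refine ⟨hDG, q, hq, hq0, ?_⟩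
  have hkey := hval hDG
  linear_combination hv + hkey

end Summit.BirchSwinnertonDyer.BirchSwinnertonDyer.Theorems.PrintCf2.DisegniPairTwo

end
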